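import Literature.NumberTheory.GelbartRogawski1991.UnitaryDualPairThetaKernel
import Literature.NumberTheory.Automorphic.AdelicUnitaryGroupDatum
import Literature.NumberTheory.NumberFields.CMFieldTotallyNegativeGenerator
import HarnessLib

-- buildfix G11b-3 recipe (LEDGER B13-1/B13-3): elaborate sequentially so the trailing `attribute [implicit_reducible]`
-- block (reducibilityCoreExt is keyed to the async environment branch) is in force at `.olean` export.
set_option Elab.async false

/-!
# The theta-kernel datum of a unitary dual pair over a CM field `L / L⁺` (CM currency)

Topic `NumberTheory/GelbartRogawski1991`; namespace
`Literature.NumberTheory.GelbartRogawski1991.UnitaryDualPair` (continues `UnitaryDualPairThetaKernel`).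

KERNEL JUNCTION (no new named fact).  `UnitaryDualPairSplittingDatum` / `UnitaryDualPairThetaKernel` are
typed over a general quadratic extension `E/F` with data `(c, δ, d, T_V, T_W, e)`.  A consumer working with
a CM field `L` (the unitary groups `U(H)(𝔸_{L⁺}) = adelicUnitaryGroup L H` of `Automorphic.AdelicUnitaryGroup`,
hermitian `H ∈ M_N(L)`) needs the specialisation
`F := L⁺ = maximalRealSubfield L`, `E := L`, `c := complexConj`, and this file supplies it:

* `imagUnit L` — a nonzero purely imaginary element `δ = x - x̄` (`complexConj δ = -δ`, `δ ≠ 0`,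
  `δ² = imagUnitSq L ∈ L⁺`); the three hypotheses `hcδ`, `hδ`, `hd` of the generic files;
* `realDiagonal L d hd` — for `d : Fin N → L` with `d̄ᵢ = dᵢ`, the diagonal matrix `diag(d) ∈ M_N(L⁺)`
  (`realDiagonal_map : (realDiagonal L d hd).map (algebraMap L⁺ L) = diagonal d`, `realDiagonal_isSymm`,
  `isUnit_det_realDiagonal` for `dᵢ ≠ 0`); the hypotheses `hV`, `hVd`, `hJV` (a hermitian form admits
  such a diagonal frame: `QuadraticForms.Landherr.exists_congr_diagonal`);
* the CM CARRIER BRIDGE `cmAdelicEquiv L N J : adelicUnitaryGroup L J ≃ₜ* UnitaryGroup.adelic L⁺ L c N J`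
  (the two subgroups of `GL_N(𝔸_L)` are EQUAL, `UnitaryGroup.adelic_complexConj`; identity on matrices),
  with `cmAdelicEquiv_mem_range_toAdelic_iff : cmAdelicEquiv γ ∈ U(J)(L⁺) ↔ γ ∈ adelicUnitaryRat L J`, the
  `LocallyCompactSpace` instance of the generic carrier in the CM case, and the FRAME TRANSPORT
  `cmFrameEquiv L g H d hg : adelicUnitaryGroup L H ≃ₜ* UnitaryGroup.adelic L⁺ L c N (diagonal d)` for
  `ᵗḡ H g = diagonal d` (`adelicUnitaryGroupCongr` ∘ `cmAdelicEquiv`), again respecting rational points;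
* `cmSplittingDatum L e dV … dW …` — the `SplittingDatum` of the pair `(U(diag dV), U(diag dW))` over `L/L⁺`
  (so that `(cmSplittingDatum …).CompatibleSplitting` is [GelbartRogawski1991, Prop. 3.1.1] AT this pair —
  the cited Prop, instantiated, not restated);
* `cmThetaKernelDatum hGR hρ SK hSK` — WEIL'S THETA-KERNEL DATUM of `U(diag dV) × U(diag dW)` over `L/L⁺`
  (`thetaKernelDatumOfCompatibleSplitting` in the CM currency) with its `rfl` API.

References: A. Weil, Acta Math. 111 (1964), Chap. III n° 41 [Weil1964]; S. Gelbart, J. Rogawski, Invent. Math.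
105 (1991) §3.1–3.2 [GelbartRogawski1991]; C. P. Mok, Mem. AMS 235 (2015) §1 (unitary groups over CM fields)
[Mok2014].
-/

noncomputable section

open scoped Matrix Kronecker
open NumberField
open Literature.RepresentationTheory.HeisenbergGroup
open Literature.NumberTheory.Automorphic
open Literature.NumberTheory.Weil1964

namespace Literature.NumberTheory.GelbartRogawski1991

namespace UnitaryDualPair

/-! ## §1. A purely imaginary unit `δ` of the CM field -/

section ImagUnit

variable (L : Type) [Field L] [NumberField L] [IsCMField L]

/-- **a nonzero purely imaginary element** `δ := x - x̄` of the CM field `L` (`x` any element moved by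
complex conjugation, `Literature.NumberTheory.NumberFields.IsCMField.exists_complexConj_ne`). [folklore] -/
def imagUnit : L :=
  Classical.choose (Literature.NumberTheory.NumberFields.IsCMField.exists_complexConj_ne L) -
    IsCMField.complexConj L
      (Classical.choose (Literature.NumberTheory.NumberFields.IsCMField.exists_complexConj_ne L))

/-- `δ̄ = -δ`. [folklore] -/
theorem complexConj_imagUnit : IsCMField.complexConj L (imagUnit L) = -imagUnit L := by
  unfold imagUnit
  rw [map_sub, IsCMField.complexConj_apply_apply, neg_sub]

/-- `δ ≠ 0`. [folklore] -/
theorem imagUnit_ne_zero : imagUnit L ≠ 0 := fun h =>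
  Classical.choose_spec (Literature.NumberTheory.NumberFields.IsCMField.exists_complexConj_ne L)
    (sub_eq_zero.1 h).symm

/-- `δ² ∈ L⁺`, as an element of the maximal real subfield. [folklore] -/
def imagUnitSq : ↥(maximalRealSubfield L) :=
  ⟨imagUnit L * imagUnit L, by
    simpa only [sq] using
      Literature.NumberTheory.NumberFields.sq_mem_maximalRealSubfield_of_complexConj_eq_neg
        (complexConj_imagUnit L)⟩

/-- `δ · δ = δ²` read in `L`. [folklore] -/
theorem imagUnit_mul_self :
    imagUnit L * imagUnit L = algebraMap (↥(maximalRealSubfield L)) L (imagUnitSq L) := rfl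

end ImagUnit

/-! ## §2. Real diagonal Gram matrices -/

section RealDiagonal

variable (L : Type) [Field L] [NumberField L] [IsCMField L] {N : ℕ}
variable (d : Fin N → L) (hd : ∀ i, IsCMField.complexConj L (d i) = d i)

/-- `diag(d) ∈ M_N(L⁺)` for conjugation-fixed `dᵢ`. [folklore] -/
def realDiagonal : Matrix (Fin N) (Fin N) ↥(maximalRealSubfield L) :=
  Matrix.diagonal fun i => (⟨d i, (IsCMField.complexConj_eq_self_iff (K := L) (d i)).1 (hd i)⟩ : ↥(maximalRealSubfield L))

/-- `diag(d)` is symmetric. [folklore] -/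
theorem realDiagonal_isSymm : (realDiagonal L d hd).IsSymm := Matrix.isSymm_diagonal _

/-- `diag(d) ⊗_{L⁺} L = diag(d) ∈ M_N(L)`. [folklore] -/
theorem realDiagonal_map :
    (realDiagonal L d hd).map (algebraMap (↥(maximalRealSubfield L)) L) = Matrix.diagonal d := by
  rw [realDiagonal, Matrix.diagonal_map (map_zero _)]
  rfl

/-- `det diag(d)` is a unit when all `dᵢ ≠ 0`. [folklore] -/
theorem isUnit_det_realDiagonal (h0 : ∀ i, d i ≠ 0) : IsUnit (realDiagonal L d hd).det := by
  rw [realDiagonal, Matrix.det_diagonal, isUnit_iff_ne_zero, Finset.prod_ne_zero_iff]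
  intro i _ h
  exact h0 i (congrArg Subtype.val h)

end RealDiagonal

/-! ## §3. The CM carrier bridge `adelicUnitaryGroup L J = UnitaryGroup.adelic L⁺ L c N J` -/

section Carrier

variable (L : Type) [Field L] [NumberField L] [IsCMField L] (N : ℕ) (J : Matrix (Fin N) (Fin N) L)

/-- The generic adelic carrier in the CM case is locally compact (it IS `adelicUnitaryGroup L J`,
`UnitaryGroup.adelic_complexConj`; `locallyCompactSpace_adelicUnitaryGroup`). [folklore] -/
instance locallyCompactSpace_adelic_complexConj :
    LocallyCompactSpace ↥(UnitaryGroup.adelic (↥(maximalRealSubfield L)) L (IsCMField.complexConj L) N J) := by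
  rw [UnitaryGroup.adelic_complexConj]
  infer_instance

/-- **The CM carrier bridge** `U(J)(𝔸_{L⁺})`: `adelicUnitaryGroup L J ≃ₜ* UnitaryGroup.adelic L⁺ L c N J`
(equal subgroups of `GL_N(𝔸_L)`, `UnitaryGroup.adelic_complexConj`; the identity on matrices).
[cite: Mok2014, §1 Notation p. 5] -/
def cmAdelicEquiv :
    ↥(adelicUnitaryGroup L J) ≃ₜ* ↥(UnitaryGroup.adelic (↥(maximalRealSubfield L)) L (IsCMField.complexConj L) N J) where
  toMulEquiv := MulEquiv.subgroupCongr (UnitaryGroup.adelic_complexConj L N J).symm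
  continuous_toFun := Continuous.subtype_mk continuous_subtype_val _
  continuous_invFun := Continuous.subtype_mk continuous_subtype_val _

/-- `cmAdelicEquiv` is the identity on matrices. [folklore] -/
@[simp] theorem coe_cmAdelicEquiv (g : ↥(adelicUnitaryGroup L J)) :
    ((cmAdelicEquiv L N J g : ↥(UnitaryGroup.adelic (↥(maximalRealSubfield L)) L (IsCMField.complexConj L) N J)) :
        GL (Fin N) (AdeleRing (𝓞 L) L)) = g := rfl

/-- … and so is its inverse. [folklore] -/
@[simp] theorem coe_cmAdelicEquiv_symm
    (g : ↥(UnitaryGroup.adelic (↥(maximalRealSubfield L)) L (IsCMField.complexConj L) N J)) :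
    (((cmAdelicEquiv L N J).symm g : ↥(adelicUnitaryGroup L J)) : GL (Fin N) (AdeleRing (𝓞 L) L)) = g := rfl

/-- **rational points correspond**: `cmAdelicEquiv γ ∈ U(J)(L⁺) = (toAdelic …).range ↔ γ ∈ adelicUnitaryRat L J`
(`UnitaryGroup.rational_complexConj`: both are the diagonal images of `{g ∈ GL_N(L) | ᵗḡ J g = J}`).
[cite: Mok2014, §1 Notation p. 5] -/
theorem cmAdelicEquiv_mem_range_toAdelic_iff (γ : ↥(adelicUnitaryGroup L J)) :
    cmAdelicEquiv L N J γ ∈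
        (UnitaryGroup.toAdelic (↥(maximalRealSubfield L)) L (IsCMField.complexConj L) N J).range ↔
      γ ∈ adelicUnitaryRat L J := by
  rw [mem_adelicUnitaryRat_iff, MonoidHom.mem_range]
  constructor
  · rintro ⟨g, hg⟩
    refine ⟨g.1, ?_, congrArg (fun x => (Subtype.val x : GL (Fin N) (AdeleRing (𝓞 L) L))) hg⟩
    rw [← UnitaryGroup.rational_complexConj]
    exact g.2
  · rintro ⟨g, hg, hgγ⟩
    refine ⟨⟨g, ?_⟩, Subtype.ext hgγ⟩
    rw [UnitaryGroup.rational_complexConj]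
    exact hg

/-- the inverse direction, as used for lattice hypotheses: `γ ∈ adelicUnitaryRat L J → cmAdelicEquiv γ ∈ U(J)(L⁺)`.
[folklore] -/
theorem cmAdelicEquiv_mem_range_toAdelic {γ : ↥(adelicUnitaryGroup L J)} (hγ : γ ∈ adelicUnitaryRat L J) :
    cmAdelicEquiv L N J γ ∈
      (UnitaryGroup.toAdelic (↥(maximalRealSubfield L)) L (IsCMField.complexConj L) N J).range :=
  (cmAdelicEquiv_mem_range_toAdelic_iff L N J γ).2 hγ

variable {N}

/-- congruence by `g` inverts to congruence by `g⁻¹`: `ᵗḡ H g = H' ⇒ ᵗ(g⁻¹)‾ H' g⁻¹ = H`. [folklore] -/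
theorem congr_inv_of_congr {n : Type*} [Fintype n] [DecidableEq n] (g : GL n L) (H H' : Matrix n n L)
    (hg : ((g : Matrix n n L).map (cmConjRingHom L))ᵀ * H * (g : Matrix n n L) = H') :
    (((g⁻¹ : GL n L) : Matrix n n L).map (cmConjRingHom L))ᵀ * H' * ((g⁻¹ : GL n L) : Matrix n n L) = H := by
  have h1 : ((g : Matrix n n L).map (cmConjRingHom L)) * (((g⁻¹ : GL n L) : Matrix n n L).map (cmConjRingHom L)) = 1 := by
    rw [← Matrix.map_mul, ← Units.val_mul, mul_inv_cancel, Units.val_one, Matrix.map_one _ (map_zero _) (map_one _)]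
  have h2 : (g : Matrix n n L) * ((g⁻¹ : GL n L) : Matrix n n L) = 1 := by
    rw [← Units.val_mul, mul_inv_cancel, Units.val_one]
  calc (((g⁻¹ : GL n L) : Matrix n n L).map (cmConjRingHom L))ᵀ * H' * ((g⁻¹ : GL n L) : Matrix n n L)
      = (((g⁻¹ : GL n L) : Matrix n n L).map (cmConjRingHom L))ᵀ * ((g : Matrix n n L).map (cmConjRingHom L))ᵀ *
          H * ((g : Matrix n n L) * ((g⁻¹ : GL n L) : Matrix n n L)) := by
        rw [← hg]; simp only [Matrix.mul_assoc]
    _ = (((g : Matrix n n L).map (cmConjRingHom L)) * (((g⁻¹ : GL n L) : Matrix n n L).map (cmConjRingHom L)))ᵀ *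
          H * ((g : Matrix n n L) * ((g⁻¹ : GL n L) : Matrix n n L)) := by
        rw [Matrix.transpose_mul]
    _ = H := by rw [h1, h2, Matrix.transpose_one, Matrix.one_mul, Matrix.mul_one]

/-- **FRAME TRANSPORT**: for a frame `g ∈ GL_N(L)` with `ᵗḡ H g = diagonal d`, the topological-group isomorphism
`U(H)(𝔸_{L⁺}) ≃ₜ* U(diag d)(𝔸_{L⁺})`, `x ↦ g_𝔸⁻¹ x g_𝔸`, landing in the generic carrier
`UnitaryGroup.adelic L⁺ L c N (diagonal d)` (`adelicUnitaryGroupCongr` for `g⁻¹`, then `cmAdelicEquiv`).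
[folklore] -/
def cmFrameEquiv (g : GL (Fin N) L) (H : Matrix (Fin N) (Fin N) L) (d : Fin N → L)
    (hg : ((g : Matrix (Fin N) (Fin N) L).map (cmConjRingHom L))ᵀ * H * (g : Matrix (Fin N) (Fin N) L) =
      Matrix.diagonal d) :
    ↥(adelicUnitaryGroup L H) ≃ₜ*
      ↥(UnitaryGroup.adelic (↥(maximalRealSubfield L)) L (IsCMField.complexConj L) N (Matrix.diagonal d)) :=
  (adelicUnitaryGroupCongr L g⁻¹ (Matrix.diagonal d) H (congr_inv_of_congr L g H _ hg)).trans
    (cmAdelicEquiv L N (Matrix.diagonal d))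

/-- `cmFrameEquiv g H d hg x = g_𝔸⁻¹ x g_𝔸` in `GL_N(𝔸_L)`. [folklore] -/
@[simp] theorem coe_cmFrameEquiv (g : GL (Fin N) L) (H : Matrix (Fin N) (Fin N) L) (d : Fin N → L)
    (hg : ((g : Matrix (Fin N) (Fin N) L).map (cmConjRingHom L))ᵀ * H * (g : Matrix (Fin N) (Fin N) L) =
      Matrix.diagonal d) (x : ↥(adelicUnitaryGroup L H)) :
    ((cmFrameEquiv L g H d hg x :
        ↥(UnitaryGroup.adelic (↥(maximalRealSubfield L)) L (IsCMField.complexConj L) N (Matrix.diagonal d))) :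
          GL (Fin N) (AdeleRing (𝓞 L) L)) =
      (toAdeleGL L g)⁻¹ * x * toAdeleGL L g := by
  show toAdeleGL L g⁻¹ * (x : GL (Fin N) (AdeleRing (𝓞 L) L)) * (toAdeleGL L g⁻¹)⁻¹ = _
  rw [map_inv, inv_inv]

/-- `cmFrameEquiv` is continuous (as a bare function; for `Continuous`-hypothesis consumers). [folklore] -/
theorem continuous_cmFrameEquiv (g : GL (Fin N) L) (H : Matrix (Fin N) (Fin N) L) (d : Fin N → L)
    (hg : ((g : Matrix (Fin N) (Fin N) L).map (cmConjRingHom L))ᵀ * H * (g : Matrix (Fin N) (Fin N) L) =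
      Matrix.diagonal d) :
    Continuous (cmFrameEquiv L g H d hg) :=
  (cmFrameEquiv L g H d hg).continuous

/-- **frame transport respects rational points**: `γ ∈ U(H)(L⁺) ⇒ g⁻¹ γ g ∈ U(diag d)(L⁺)`. [folklore] -/
theorem cmFrameEquiv_mem_range_toAdelic (g : GL (Fin N) L) (H : Matrix (Fin N) (Fin N) L) (d : Fin N → L)
    (hg : ((g : Matrix (Fin N) (Fin N) L).map (cmConjRingHom L))ᵀ * H * (g : Matrix (Fin N) (Fin N) L) =
      Matrix.diagonal d) {γ : ↥(adelicUnitaryGroup L H)} (hγ : γ ∈ adelicUnitaryRat L H) :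
    cmFrameEquiv L g H d hg γ ∈
      (UnitaryGroup.toAdelic (↥(maximalRealSubfield L)) L (IsCMField.complexConj L) N (Matrix.diagonal d)).range :=
  cmAdelicEquiv_mem_range_toAdelic L N (Matrix.diagonal d)
    (adelicUnitaryGroupCongr_mem_rat L g⁻¹ (Matrix.diagonal d) H (congr_inv_of_congr L g H _ hg) hγ)

end Carrier

/-! ## §4. The splitting datum and the theta-kernel datum of `U(diag dV) × U(diag dW)` over `L/L⁺` -/

section CMDatum

variable (L : Type) [Field L] [NumberField L] [IsCMField L] {N M n : ℕ} (e : Fin N × Fin M ≃ Fin n)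
variable (dV : Fin N → L) (hdV : ∀ i, IsCMField.complexConj L (dV i) = dV i) (hdV0 : ∀ i, dV i ≠ 0)
variable (dW : Fin M → L) (hdW : ∀ i, IsCMField.complexConj L (dW i) = dW i) (hdW0 : ∀ i, dW i ≠ 0)

/-- **the splitting datum of the CM dual pair `(U(diag dV), U(diag dW))`** over `L/L⁺`: `UnitaryDualPair.splittingDatum`
at `F := L⁺`, `E := L`, `c := complexConj`, `δ := imagUnit L`, `T_V := diag(dV)`, `T_W := diag(dW)`.
Its `CompatibleSplitting` is [GelbartRogawski1991, Prop. 3.1.1] for `G₁ = U(diag dV ⊗ diag dW)`.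
[cite: GelbartRogawski1991, §3.1 Prop. 3.1.1 p. 455 L1–3] -/
def cmSplittingDatum :
    SplittingDatum
      (symplecticGroup (polar (adelicForm (↥(maximalRealSubfield L)) (Fin n)
        (adelicGram (↥(maximalRealSubfield L)) e (realDiagonal L dV hdV) (realDiagonal L dW hdW)))))
      (adelicMpCont (↥(maximalRealSubfield L)) (Fin n)
        (adelicGram (↥(maximalRealSubfield L)) e (realDiagonal L dV hdV) (realDiagonal L dW hdW)))
      (UnitaryGroup.adelicPair (↥(maximalRealSubfield L)) L (IsCMField.complexConj L) N M
        (Matrix.diagonal dV) (Matrix.diagonal dW)) :=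
  splittingDatum (↥(maximalRealSubfield L)) L (IsCMField.complexConj L) N M e (Matrix.diagonal dV) (Matrix.diagonal dW)
    (complexConj_imagUnit L) (imagUnit_ne_zero L) (imagUnit_mul_self L)
    (realDiagonal_isSymm L dV hdV) (realDiagonal_isSymm L dW hdW)
    (isUnit_det_realDiagonal L dV hdV hdV0) (isUnit_det_realDiagonal L dW hdW hdW0)
    (realDiagonal_map L dV hdV).symm (realDiagonal_map L dW hdW).symm

/-- `cmSplittingDatum` IS the generic `splittingDatum` at the CM data (definitional). [folklore] -/
theorem cmSplittingDatum_eq :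
    cmSplittingDatum L e dV hdV hdV0 dW hdW hdW0 =
      splittingDatum (↥(maximalRealSubfield L)) L (IsCMField.complexConj L) N M e (Matrix.diagonal dV)
        (Matrix.diagonal dW) (complexConj_imagUnit L) (imagUnit_ne_zero L) (imagUnit_mul_self L)
        (realDiagonal_isSymm L dV hdV) (realDiagonal_isSymm L dW hdW)
        (isUnit_det_realDiagonal L dV hdV hdV0) (isUnit_det_realDiagonal L dW hdW hdW0)
        (realDiagonal_map L dV hdV).symm (realDiagonal_map L dW hdW).symm := rfl

/-- **the chosen compatible pair splitting of the CM dual pair** `s_pair : U(diag dV)(𝔸) × U(diag dW)(𝔸) →* Mp_ψ(𝕎_𝔸)ᶜᵒⁿᵗ`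
(`pairSplitting (splittingOf hGR)` at the CM data). [folklore] -/
def cmPairSplitting (hGR : (cmSplittingDatum L e dV hdV hdV0 dW hdW hdW0).CompatibleSplitting) :
    ↥(UnitaryGroup.adelic (↥(maximalRealSubfield L)) L (IsCMField.complexConj L) N (Matrix.diagonal dV)) ×
        ↥(UnitaryGroup.adelic (↥(maximalRealSubfield L)) L (IsCMField.complexConj L) M (Matrix.diagonal dW)) →*
      adelicMpCont (↥(maximalRealSubfield L)) (Fin n)
        (adelicGram (↥(maximalRealSubfield L)) e (realDiagonal L dV hdV) (realDiagonal L dW hdW)) :=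
  pairSplitting (↥(maximalRealSubfield L)) L (IsCMField.complexConj L) N M e (Matrix.diagonal dV) (Matrix.diagonal dW)
    (splittingOf (↥(maximalRealSubfield L)) L (IsCMField.complexConj L) N M e (Matrix.diagonal dV)
      (Matrix.diagonal dW) (complexConj_imagUnit L) (imagUnit_ne_zero L) (imagUnit_mul_self L)
      (realDiagonal_isSymm L dV hdV) (realDiagonal_isSymm L dW hdW)
      (isUnit_det_realDiagonal L dV hdV hdV0) (isUnit_det_realDiagonal L dW hdW hdW0)
      (realDiagonal_map L dV hdV).symm (realDiagonal_map L dW hdW).symm hGR)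

/-- the CM pair splitting is continuous (input `hs` of `Weil1964.AdelicMetaplecticThetaMajorants`).
[cite: GelbartRogawski1991, §3.1 Prop. 3.1.1 p. 455 L1–3] -/
theorem continuous_cmPairSplitting (hGR : (cmSplittingDatum L e dV hdV hdV0 dW hdW hdW0).CompatibleSplitting) :
    Continuous (cmPairSplitting L e dV hdV hdV0 dW hdW hdW0 hGR) :=
  continuous_pairSplitting_splittingOf _ _ _ _ _ _ _ _ _ _ _ _ _ _ _ _ _ hGR

/-- `π(s_pair(x, y)) = ι(x ⊗ 1 · 1 ⊗ y)` for the CM pair splitting. [cite: GelbartRogawski1991, §3.1 Prop. 3.1.1 p. 455 L1–3] -/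
theorem proj_cmPairSplitting (hGR : (cmSplittingDatum L e dV hdV hdV0 dW hdW hdW0).CompatibleSplitting)
    (p : ↥(UnitaryGroup.adelic (↥(maximalRealSubfield L)) L (IsCMField.complexConj L) N (Matrix.diagonal dV)) ×
      ↥(UnitaryGroup.adelic (↥(maximalRealSubfield L)) L (IsCMField.complexConj L) M (Matrix.diagonal dW))) :
    adelicMpCont.proj (↥(maximalRealSubfield L)) (Fin n)
        (adelicGram (↥(maximalRealSubfield L)) e (realDiagonal L dV hdV) (realDiagonal L dW hdW))
        (cmPairSplitting L e dV hdV hdV0 dW hdW hdW0 hGR p) =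
      (cmSplittingDatum L e dV hdV hdV0 dW hdW hdW0).toSp
        (UnitaryGroup.adelicInl (↥(maximalRealSubfield L)) L (IsCMField.complexConj L) N M (Matrix.diagonal dV)
            (Matrix.diagonal dW) p.1 *
          UnitaryGroup.adelicInr (↥(maximalRealSubfield L)) L (IsCMField.complexConj L) N M (Matrix.diagonal dV)
            (Matrix.diagonal dW) p.2) :=
  proj_pairSplitting_splittingOf _ _ _ _ _ _ _ _ _ _ _ _ _ _ _ _ _ hGR p

/-- **`ω_ψ ∘ s_pair` for the CM dual pair** (`pairRep` at the chosen splitting). [cite: Weil1964, Chap. III n° 41 p. 193] -/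
def cmPairRep (hGR : (cmSplittingDatum L e dV hdV hdV0 dW hdW hdW0).CompatibleSplitting) :
    Representation ℂ
      (↥(UnitaryGroup.adelic (↥(maximalRealSubfield L)) L (IsCMField.complexConj L) N (Matrix.diagonal dV)) ×
        ↥(UnitaryGroup.adelic (↥(maximalRealSubfield L)) L (IsCMField.complexConj L) M (Matrix.diagonal dW)))
      (piSchwartzBruhat (↥(maximalRealSubfield L)) (Fin n)) :=
  pairRep (↥(maximalRealSubfield L)) L (IsCMField.complexConj L) N M e (Matrix.diagonal dV) (Matrix.diagonal dW)
    (splittingOf _ _ _ _ _ _ _ _ _ _ _ _ _ _ _ _ _ hGR)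

/-- `cmPairRep hGR p Φ = ω_ψ(s_pair p) Φ`. [folklore] -/
@[simp] theorem cmPairRep_apply (hGR : (cmSplittingDatum L e dV hdV hdV0 dW hdW hdW0).CompatibleSplitting)
    (p : ↥(UnitaryGroup.adelic (↥(maximalRealSubfield L)) L (IsCMField.complexConj L) N (Matrix.diagonal dV)) ×
      ↥(UnitaryGroup.adelic (↥(maximalRealSubfield L)) L (IsCMField.complexConj L) M (Matrix.diagonal dW)))
    (Φ : piSchwartzBruhat (↥(maximalRealSubfield L)) (Fin n)) :
    cmPairRep L e dV hdV hdV0 dW hdW hdW0 hGR p Φ =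
      adelicMpCont.omega (↥(maximalRealSubfield L)) (Fin n)
        (adelicGram (↥(maximalRealSubfield L)) e (realDiagonal L dV hdV) (realDiagonal L dW hdW))
        (cmPairSplitting L e dV hdV hdV0 dW hdW hdW0 hGR p) Φ := rfl

/-- **Weil's Théorème 6 for the CM dual pair**: `ω_ψ(s_pair(γ_U, γ))` fixes `Θ` for rational `γ_U`, `γ`
(input `hrat` of `Weil1964.ThetaKernelDatum.adelicOfDualPair`). [cite: Weil1964, Chap. III n° 41 Thm 6 p. 193;
GelbartRogawski1991, §3.1 Prop. 3.1.1 p. 455 L1–3] -/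
theorem cmPairRep_toHomUnits_mem_thetaStabilizer
    (hGR : (cmSplittingDatum L e dV hdV hdV0 dW hdW hdW0).CompatibleSplitting)
    {γU : ↥(UnitaryGroup.adelic (↥(maximalRealSubfield L)) L (IsCMField.complexConj L) N (Matrix.diagonal dV))}
    (hγU : γU ∈ (UnitaryGroup.toAdelic (↥(maximalRealSubfield L)) L (IsCMField.complexConj L) N (Matrix.diagonal dV)).range)
    {γ : ↥(UnitaryGroup.adelic (↥(maximalRealSubfield L)) L (IsCMField.complexConj L) M (Matrix.diagonal dW))}
    (hγ : γ ∈ (UnitaryGroup.toAdelic (↥(maximalRealSubfield L)) L (IsCMField.complexConj L) M (Matrix.diagonal dW)).range) :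
    (cmPairRep L e dV hdV hdV0 dW hdW hdW0 hGR).toHomUnits (γU, γ) ∈ thetaStabilizer (↥(maximalRealSubfield L)) (Fin n) :=
  pairRep_toHomUnits_mem_thetaStabilizer _ _ _ _ _ _ _ _ _ _ _ _ _ _ _ _ _
    (splittingOf_isCompatible _ _ _ _ _ _ _ _ _ _ _ _ _ _ _ _ _ hGR) hγU hγ

/-- **WEIL'S THETA-KERNEL DATUM OF THE CM DUAL PAIR `U(diag dV) × U(diag dW)` over `L/L⁺`, CONSTRUCTED**
(`thetaKernelDatumOfCompatibleSplitting` in the CM currency): hypotheses — [GelbartRogawski1991, Prop. 3.1.1] at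
this pair (`hGR`), Weil's majorants for `ω_ψ ∘ s_pair` (`hρ`, typed LITERALLY in the shape
`HasThetaMajorants fun p Φ => adelicMpCont.omega … (cmPairSplitting … p) Φ` that `Weil1964.AdelicMetaplecticThetaMajorants`
delivers for `s := cmPairSplitting …`), a `U(diag dW)(𝔸)`-stable `SK`.
[cite: Weil1964, Chap. III n° 41 Thm 6 p. 193] -/
def cmThetaKernelDatum (hGR : (cmSplittingDatum L e dV hdV hdV0 dW hdW hdW0).CompatibleSplitting)
    (hρ : HasThetaMajorants fun
      (p : ↥(UnitaryGroup.adelic (↥(maximalRealSubfield L)) L (IsCMField.complexConj L) N (Matrix.diagonal dV)) ×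
        ↥(UnitaryGroup.adelic (↥(maximalRealSubfield L)) L (IsCMField.complexConj L) M (Matrix.diagonal dW)))
      (Φ : piSchwartzBruhat (↥(maximalRealSubfield L)) (Fin n)) =>
        adelicMpCont.omega (↥(maximalRealSubfield L)) (Fin n)
          (adelicGram (↥(maximalRealSubfield L)) e (realDiagonal L dV hdV) (realDiagonal L dW hdW))
          (cmPairSplitting L e dV hdV hdV0 dW hdW hdW0 hGR p) Φ)
    (SK : Set (piSchwartzBruhat (↥(maximalRealSubfield L)) (Fin n)))
    (hSK : ∀ (h : ↥(UnitaryGroup.adelic (↥(maximalRealSubfield L)) L (IsCMField.complexConj L) M (Matrix.diagonal dW)))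
      (Φ : piSchwartzBruhat (↥(maximalRealSubfield L)) (Fin n)), Φ ∈ SK →
        cmPairRep L e dV hdV hdV0 dW hdW hdW0 hGR (1, h) Φ ∈ SK) :=
  thetaKernelDatumOfCompatibleSplitting (↥(maximalRealSubfield L)) L (IsCMField.complexConj L) N M e
    (Matrix.diagonal dV) (Matrix.diagonal dW) (complexConj_imagUnit L) (imagUnit_ne_zero L) (imagUnit_mul_self L)
    (realDiagonal_isSymm L dV hdV) (realDiagonal_isSymm L dW hdW)
    (isUnit_det_realDiagonal L dV hdV hdV0) (isUnit_det_realDiagonal L dW hdW hdW0)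
    (realDiagonal_map L dV hdV).symm (realDiagonal_map L dW hdW).symm hGR hρ SK hSK

variable (hGR : (cmSplittingDatum L e dV hdV hdV0 dW hdW hdW0).CompatibleSplitting)
  (hρ : HasThetaMajorants fun
    (p : ↥(UnitaryGroup.adelic (↥(maximalRealSubfield L)) L (IsCMField.complexConj L) N (Matrix.diagonal dV)) ×
      ↥(UnitaryGroup.adelic (↥(maximalRealSubfield L)) L (IsCMField.complexConj L) M (Matrix.diagonal dW)))
    (Φ : piSchwartzBruhat (↥(maximalRealSubfield L)) (Fin n)) =>
      adelicMpCont.omega (↥(maximalRealSubfield L)) (Fin n)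
        (adelicGram (↥(maximalRealSubfield L)) e (realDiagonal L dV hdV) (realDiagonal L dW hdW))
        (cmPairSplitting L e dV hdV hdV0 dW hdW hdW0 hGR p) Φ)
  (SK : Set (piSchwartzBruhat (↥(maximalRealSubfield L)) (Fin n)))
  (hSK : ∀ (h : ↥(UnitaryGroup.adelic (↥(maximalRealSubfield L)) L (IsCMField.complexConj L) M (Matrix.diagonal dW)))
    (Φ : piSchwartzBruhat (↥(maximalRealSubfield L)) (Fin n)), Φ ∈ SK →
      cmPairRep L e dV hdV hdV0 dW hdW hdW0 hGR (1, h) Φ ∈ SK)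

/-- the lift of the CM datum is the identity. [folklore] -/
theorem cmThetaKernelDatum_s :
    (cmThetaKernelDatum L e dV hdV hdV0 dW hdW hdW0 hGR hρ SK hSK).s = MonoidHom.id _ := rfl

/-- the Weil action of the CM datum: `W.act p Φ = ω_ψ(s_pair p) Φ`. [cite: Weil1964, Chap. III n° 41 p. 193] -/
theorem cmThetaKernelDatum_act
    (p : ↥(UnitaryGroup.adelic (↥(maximalRealSubfield L)) L (IsCMField.complexConj L) N (Matrix.diagonal dV)) ×
      ↥(UnitaryGroup.adelic (↥(maximalRealSubfield L)) L (IsCMField.complexConj L) M (Matrix.diagonal dW)))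
    (Φ : piSchwartzBruhat (↥(maximalRealSubfield L)) (Fin n)) :
    (cmThetaKernelDatum L e dV hdV hdV0 dW hdW hdW0 hGR hρ SK hSK).W.act p Φ =
      cmPairRep L e dV hdV hdV0 dW hdW hdW0 hGR p Φ := rfl

/-- the `K`-type set of the CM datum is the given `SK`. [folklore] -/
theorem cmThetaKernelDatum_SK : (cmThetaKernelDatum L e dV hdV hdV0 dW hdW hdW0 hGR hρ SK hSK).SK = SK := rfl

/-- **the theta kernel of the CM dual pair**: `θ_Φ(x, h) = Θ(ω_ψ(s_pair(x⁻¹, h⁻¹)) Φ)`.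
[cite: Weil1964, Chap. III n° 41 Thm 6 p. 193] -/
theorem cmThetaKernelDatum_thetaFun_mk (Φ : piSchwartzBruhat (↥(maximalRealSubfield L)) (Fin n))
    (x : ↥(UnitaryGroup.adelic (↥(maximalRealSubfield L)) L (IsCMField.complexConj L) N (Matrix.diagonal dV)))
    (h : ↥(UnitaryGroup.adelic (↥(maximalRealSubfield L)) L (IsCMField.complexConj L) M (Matrix.diagonal dW))) :
    (cmThetaKernelDatum L e dV hdV hdV0 dW hdW hdW0 hGR hρ SK hSK).thetaFun Φ (x, h) =
      thetaDistLM (↥(maximalRealSubfield L)) (Fin n) (cmPairRep L e dV hdV hdV0 dW hdW hdW0 hGR (x⁻¹, h⁻¹) Φ) := rfl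

/-- the theta kernel of the CM dual pair is continuous. [folklore] -/
theorem continuous_cmThetaKernelDatum_thetaFun (Φ : piSchwartzBruhat (↥(maximalRealSubfield L)) (Fin n)) :
    Continuous ((cmThetaKernelDatum L e dV hdV hdV0 dW hdW hdW0 hGR hρ SK hSK).thetaFun Φ) :=
  (cmThetaKernelDatum L e dV hdV hdV0 dW hdW hdW0 hGR hρ SK hSK).continuous_thetaFun Φ

/-- the theta kernel of the CM dual pair is right-invariant under `U(diag dV)(L⁺) × U(diag dW)(L⁺)`.
[cite: Weil1964, Chap. III n° 41 Thm 6 p. 193] -/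
theorem cmThetaKernelDatum_thetaFun_mul_right (Φ : piSchwartzBruhat (↥(maximalRealSubfield L)) (Fin n))
    (p : ↥(UnitaryGroup.adelic (↥(maximalRealSubfield L)) L (IsCMField.complexConj L) N (Matrix.diagonal dV)) ×
      ↥(UnitaryGroup.adelic (↥(maximalRealSubfield L)) L (IsCMField.complexConj L) M (Matrix.diagonal dW)))
    {γU : ↥(UnitaryGroup.adelic (↥(maximalRealSubfield L)) L (IsCMField.complexConj L) N (Matrix.diagonal dV))}
    (hγU : γU ∈ (UnitaryGroup.toAdelic (↥(maximalRealSubfield L)) L (IsCMField.complexConj L) N (Matrix.diagonal dV)).range)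
    {γ : ↥(UnitaryGroup.adelic (↥(maximalRealSubfield L)) L (IsCMField.complexConj L) M (Matrix.diagonal dW))}
    (hγ : γ ∈ (UnitaryGroup.toAdelic (↥(maximalRealSubfield L)) L (IsCMField.complexConj L) M (Matrix.diagonal dW)).range) :
    (cmThetaKernelDatum L e dV hdV hdV0 dW hdW hdW0 hGR hρ SK hSK).thetaFun Φ (p * (γU, γ)) =
      (cmThetaKernelDatum L e dV hdV hdV0 dW hdW hdW0 hGR hρ SK hSK).thetaFun Φ p :=
  (cmThetaKernelDatum L e dV hdV hdV0 dW hdW hdW0 hGR hρ SK hSK).thetaFun_mul_right Φ p hγU hγ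

end CMDatum

/-! ### Build-lane note (ops-buildfix G11b-3 recipe, LEDGER B13-1, 2026-08-21)
`lean -o` (the hub build lane, never `lean`/the gate check) runs Lean 4.32's library-suggestion indexers
(`Lean.LibrarySuggestions.SymbolFrequency` / `SineQuaNon`, from their `exportEntriesFn`) over the statement of
every local theorem that is not a denied premise; on this family's statements (very large dependent binder
telescopes through the theta-kernel / dual-pair data) that fold runs for tens of minutes to hours and the build
lane kills the job (incident G11b-3, run/shared/lean/ops/buildfix/G11b-3-DOSSIER.md). `isDeniedPremise` skips
`[implicit_reducible]` constants before any fold, and a reducibility status on a *theorem* is inert (Meta never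
unfolds `thmInfo`; the kernel ignores the attribute), so the public theorems of this file are tagged
`[implicit_reducible]` purely to keep them out of that index. Only other effect: they are not offered by
`+suggestions` premise selectors. No statement or proof is changed; superseded if the operator lands a
deny-list form (`HarnessLib.PremiseIndex`). -/
set_option allowUnsafeReducibility true in
attribute [implicit_reducible]
  complexConj_imagUnit imagUnit_ne_zero imagUnit_mul_self realDiagonal_isSymm realDiagonal_map
  isUnit_det_realDiagonal coe_cmAdelicEquiv coe_cmAdelicEquiv_symm
  cmAdelicEquiv_mem_range_toAdelic_iff cmAdelicEquiv_mem_range_toAdelic congr_inv_of_congr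
  coe_cmFrameEquiv continuous_cmFrameEquiv cmFrameEquiv_mem_range_toAdelic cmSplittingDatum_eq
  continuous_cmPairSplitting proj_cmPairSplitting cmPairRep_apply
  cmPairRep_toHomUnits_mem_thetaStabilizer cmThetaKernelDatum_s cmThetaKernelDatum_act
  cmThetaKernelDatum_SK cmThetaKernelDatum_thetaFun_mk continuous_cmThetaKernelDatum_thetaFun
  cmThetaKernelDatum_thetaFun_mul_right

end UnitaryDualPair

end Literature.NumberTheory.GelbartRogawski1991

end
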